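import Literature.Probability.LatticeModels.PoissonDelaunayIsingTemplate
import HarnessLib

/-!
# The quenched Poisson–Delaunay Ising correlator is measurable in the configuration

Topic `Probability/LatticeModels`; theorem-only companion of `PoissonDelaunayIsing.lean` (no
definitions, no named facts). Main result: `aestronglyMeasurable_quenchedCorr` — for every law `P`
on locally finite configurations of a proper second countable metric space under which, for each
fixed point `y`, almost surely no two sites are equidistant from `y` (e.g. a Poisson process with a
Haar-multiple intensity, `ae_injOn_dist_of_isPoissonPointProcess`), the quenched `n`-point function
`ω ↦ quenchedCorr ω β n x = ⟨∏ᵢ σ_{p_ω(xᵢ)}⟩⁺_β` of the Ising model on the Delaunay graph of `ω`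
(`PoissonDelaunayIsing.lean`) is `P`-a.e. strongly measurable for the count σ-algebra. Hence the
annealed functions `annealedCorr`/`pdCorr` are genuine expectations, not Bochner junk.

## Proof

* `plusMonomialExpect_eq_iInf_finsetBalls` — the infimum over ALL finite volumes containing the
  marked sites (the definition of the infinite-volume plus state `plusMonomialExpect`) equals the
  infimum over the COUNTABLE family of volumes cut out by finite unions of rational balls around a
  dense sequence (`exists_finset_balls_eq`: every finite set of sites of a locally finite
  configuration is so cut out), padded by the upper bound `1`;
* each cut-off finite-volume expectation at the nearest sites is measurable
  (`measurable_finVolExpect_piecewise` of `PoissonDelaunayIsingTemplate.lean`), the good events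
  (non-empty, Delaunay graph locally finite, unique nearest sites, nearest sites in the volume) are
  measurable (`PoissonDelaunayIsingMeasurable.lean`), so `Measurable.iInf` and `Measurable.ite`
  give a measurable function which agrees with `quenchedCorr` off the null event of distance ties
  (the empty configuration and the non-locally-finite junk branch both give `0`).

## References

* S. Friedli, Y. Velenik, *Statistical mechanics of lattice systems*, CUP 2017, §3.4. [`FriedliVelenik2017`]
* W. Janke, R. Villanova, Phys. Rev. B 66 (2002) 134208 (the model). [`JankeVillanova2002`]
-/

noncomputable section

open MeasureTheory Set Metric Filter TopologicalSpace
open scoped Topology ENNReal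

namespace Literature.Probability.LatticeModels

open Literature.Analysis.FunctionSpaces

variable {E : Type*} [MetricSpace E]

/-! ### Nearest vertices -/

section NearestVertex

variable [ProperSpace E]

/-- The chosen nearest vertex is a nearest site. [folklore] -/
theorem isNearest_nearestVertex (ω : PointConfig E) (hne : (ω : Set E).Nonempty) (y : E) :
    (nearestVertex ω hne y : E) ∈ ω ∧ ∀ q ∈ ω, dist y (nearestVertex ω hne y : E) ≤ dist y q :=
  ⟨(nearestVertex ω hne y).2, fun _ hq => dist_nearestVertex_le ω hne y hq⟩

/-- If the nearest site is unique, a site is nearest iff it is the chosen nearest vertex.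
[folklore] -/
theorem isNearest_iff_eq_nearestVertex_of_existsUnique (ω : PointConfig E) (hne : (ω : Set E).Nonempty)
    {y : E} (hu : ∃! q, q ∈ ω ∧ ∀ q' ∈ ω, dist y q ≤ dist y q') (q : E) :
    (q ∈ ω ∧ ∀ q' ∈ ω, dist y q ≤ dist y q') ↔ q = (nearestVertex ω hne y : E) :=
  ⟨fun hq => hu.unique hq (isNearest_nearestVertex ω hne y),
    fun h => h ▸ isNearest_nearestVertex ω hne y⟩

/-- If no two sites are equidistant from `y` (and there is a site), the nearest site is unique.
[folklore] -/
theorem existsUnique_isNearest_of_injOn (ω : PointConfig E) (hne : (ω : Set E).Nonempty) {y : E}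
    (hinj : Set.InjOn (fun p => dist y p) (ω : Set E)) :
    ∃! q, q ∈ ω ∧ ∀ q' ∈ ω, dist y q ≤ dist y q' := by
  refine ⟨_, isNearest_nearestVertex ω hne y, fun q hq => ?_⟩
  exact hinj hq.1 (nearestVertex ω hne y).2
    (le_antisymm (hq.2 _ (nearestVertex ω hne y).2) (dist_nearestVertex_le ω hne y hq.1))

end NearestVertex

/-! ### The infinite-volume plus state as a countable infimum -/

section CountableInf

variable [ProperSpace E]

/-- **Finite sets of sites are cut out by finite unions of rational balls**: for a finite set `Λ`
of sites of a locally finite configuration in a proper separable space there is a finite set `j`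
of (dense-sequence index, rational radius) pairs such that the sites in `⋃ (i, ρ) ∈ j, ball (d i) ρ`
are exactly those of `Λ` (each site is isolated, so a small rational ball around a nearby point of
the dense sequence contains it and no other site). [folklore] -/
theorem exists_finset_balls_eq [SeparableSpace E] [Nonempty E] (ω : PointConfig E)
    (Λ : Finset (ω : Set E)) :
    ∃ j : Finset (ℕ × ℚ), ∀ w : (ω : Set E),
      w ∈ Λ ↔ (w : E) ∈ ⋃ p ∈ j, ball (denseSeq E p.1) (p.2 : ℝ) := by
  classical
  set d := denseSeq E with hd
  have hdense : DenseRange d := denseRange_denseSeq E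
  -- each site is isolated: a rational ball around a nearby dense point singles it out
  have hiso : ∀ w : (ω : Set E), ∃ p : ℕ × ℚ, (w : E) ∈ ball (d p.1) (p.2 : ℝ) ∧
      ∀ q ∈ ω, q ∈ ball (d p.1) (p.2 : ℝ) → q = w := by
    intro w
    -- an isolation radius
    set T : Set E := ((ω : Set E) ∩ closedBall (w : E) 1) \ {(w : E)} with hT
    have hTfin : T.Finite := (ω.finite_inter_closedBall (w : E) 1).subset sdiff_subset
    have hwT : (w : E) ∈ Tᶜ := fun h => h.2 rfl
    obtain ⟨ε, hε, hεT⟩ := Metric.isOpen_iff.1 hTfin.isClosed.isOpen_compl (w : E) hwT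
    set δ : ℝ := min ε 1 with hδ
    have hδpos : 0 < δ := lt_min hε one_pos
    have hsep : ∀ q ∈ ω, dist q (w : E) < δ → q = w := by
      intro q hq hqw
      by_contra hne
      have hqT : q ∈ T := ⟨⟨hq, mem_closedBall.2 (hqw.le.trans (min_le_right _ _))⟩, hne⟩
      exact hεT (mem_ball.2 (hqw.trans_le (min_le_left _ _))) hqT
    obtain ⟨i, hi⟩ := hdense.exists_dist_lt (w : E) (by positivity : (0 : ℝ) < δ / 4)
    obtain ⟨ρ, hρ₁, hρ₂⟩ := exists_rat_btwn (by linarith : δ / 4 < δ / 2)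
    refine ⟨(i, ρ), mem_ball.2 (hi.trans hρ₁), fun q hq hqb => hsep q hq ?_⟩
    rw [mem_ball] at hqb
    calc dist q (w : E) ≤ dist q (d i) + dist (d i) (w : E) := dist_triangle _ _ _
      _ < δ / 2 + δ / 4 := by rw [dist_comm (d i)]; exact add_lt_add (hqb.trans hρ₂) hi
      _ < δ := by linarith
  choose p hp using hiso
  refine ⟨Λ.image p, fun w => ?_⟩
  simp only [mem_iUnion, Finset.mem_image, exists_prop]
  constructor
  · intro hw
    exact ⟨p w, ⟨w, hw, rfl⟩, (hp w).1⟩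
  · rintro ⟨_, ⟨w', hw', rfl⟩, hmem⟩
    have : (w : E) = w' := (hp w').2 w w.2 hmem
    rwa [Subtype.ext this]

/-- **The infinite-volume plus state is a countable infimum.** The infimum defining
`plusMonomialExpect ω β v` (over ALL finite volumes containing the `v r`) equals the infimum over
the countable family of volumes `Λ j` cut out by finite unions of rational balls (all finite
volumes are of this form, `exists_finset_balls_eq`), the family being padded with the value `1`
(an upper bound, `|⟨∏ σ⟩⁺_Λ| ≤ 1`) at the indices whose volume misses some `v r`. This is the form
to which `Measurable.iInf` applies. [cite: FriedliVelenik2017, §3.4 Thm. 3.17 / Exercise 3.12] -/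
theorem plusMonomialExpect_eq_iInf_finsetBalls [SeparableSpace E] [Nonempty E] (ω : PointConfig E)
    (β : ℝ) {n : ℕ} (v : Fin n → (ω : Set E)) (Λ : Finset (ℕ × ℚ) → Finset (ω : Set E))
    (hΛ : ∀ j w, w ∈ Λ j ↔ (w : E) ∈ ⋃ p ∈ j, ball (denseSeq E p.1) (p.2 : ℝ))
    (H : Finset (ℕ × ℚ) → ℝ) (hH₁ : ∀ j, (∀ r, v r ∈ Λ j) → H j = finVolExpect ω β (Λ j) (spinMonomial v))
    (hH₂ : ∀ j, (¬ ∀ r, v r ∈ Λ j) → H j = 1) :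
    plusMonomialExpect ω β v = ⨅ j, H j := by
  classical
  have hbdd : ∀ j, -1 ≤ H j := fun j => by
    by_cases h : ∀ r, v r ∈ Λ j
    · rw [hH₁ j h]
      exact (abs_le.1 (abs_finVolExpect_spinMonomial_le_one ω β _ v)).1
    · rw [hH₂ j h]
      norm_num
  apply le_antisymm
  · refine le_ciInf fun j => ?_
    by_cases h : ∀ r, v r ∈ Λ j
    · rw [hH₁ j h]
      exact plusMonomialExpect_le ω β v (Λ j) h
    · rw [hH₂ j h]
      exact (abs_le.1 (abs_plusMonomialExpect_le_one ω β v)).2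
  · haveI : Nonempty {Λ' : Finset (ω : Set E) // ∀ i, v i ∈ Λ'} :=
      ⟨⟨Finset.univ.image v, fun i => Finset.mem_image_of_mem v (Finset.mem_univ i)⟩⟩
    rw [plusMonomialExpect]
    refine le_ciInf fun Λ' => ?_
    obtain ⟨j, hj⟩ := exists_finset_balls_eq ω Λ'.1
    have hΛj : Λ j = Λ'.1 := Finset.ext fun w => by rw [hΛ, ← hj]
    have hvj : ∀ r, v r ∈ Λ j := fun r => hΛj ▸ Λ'.2 r
    calc ⨅ j, H j ≤ H j := ciInf_le ⟨-1, by rintro _ ⟨j', rfl⟩; exact hbdd j'⟩ j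
      _ = finVolExpect ω β Λ'.1 (spinMonomial v) := by rw [hH₁ j hvj, hΛj]

end CountableInf

/-! ### Almost-everywhere measurability of the quenched correlator -/

section Quenched

variable [ProperSpace E] [SecondCountableTopology E] [MeasurableSpace E] [BorelSpace E]

/-- **The quenched Poisson–Delaunay `n`-point function is a.e. strongly measurable** in the
configuration, for the count σ-algebra, under every law `P` for which at each fixed point almost
surely no two sites are equidistant (ties of the nearest-site read-out are null; for Poisson laws
with a Haar-multiple intensity this is `ae_injOn_dist_of_isPoissonPointProcess`). Consequently the
annealed correlators `annealedCorr P β n x = ∫ quenchedCorr dP` of `PoissonDelaunayIsing.lean` are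
genuine expectations (Christ–Friedberg–Lee 1982 / Janke–Villanova 2002 averaging over the random
lattice). Proof: off a null set `quenchedCorr` agrees with the measurable function "`0` unless `ω`
is non-empty with locally finite Delaunay graph and unique nearest sites, else the countable
infimum (`plusMonomialExpect_eq_iInf_finsetBalls`) of the cut-off finite-volume expectations
(`measurable_finVolExpect_piecewise`)". [cite: JankeVillanova2002, §II (the model)] -/
theorem aestronglyMeasurable_quenchedCorr {P : Measure (PointConfig E)}
    (hP : ∀ y : E, ∀ᵐ ω ∂P, Set.InjOn (fun p => dist y p) ((ω : PointConfig E) : Set E))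
    (β : ℝ) (n : ℕ) (x : Fin n → E) :
    AEStronglyMeasurable (fun ω => quenchedCorr ω β n x) P := by
  classical
  rcases isEmpty_or_nonempty E with hE | hE
  · -- every configuration is empty
    have h : (fun ω : PointConfig E => quenchedCorr ω β n x) = fun _ => 0 := by
      funext ω
      unfold quenchedCorr
      rw [dif_neg]
      rintro ⟨p, -⟩
      exact hE.elim p
    rw [h]
    exact aestronglyMeasurable_const
  -- the countable family of volumes: finite unions of rational balls around a dense sequence
  set d := denseSeq E with hd
  set Uf : Finset (ℕ × ℚ) → Set E := fun j => ⋃ p ∈ j, ball (d p.1) (p.2 : ℝ) with hUf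
  have hUm : ∀ j, MeasurableSet (Uf j) := fun j =>
    (isOpen_biUnion fun p _ => isOpen_ball).measurableSet
  have hUb : ∀ j, Bornology.IsBounded (Uf j) := fun j =>
    (Bornology.isBounded_biUnion_finset j).2 fun p _ => isBounded_ball
  have hfin : ∀ j (ω : PointConfig E), {w : (ω : Set E) | (w : E) ∈ Uf j}.Finite := fun j ω => by
    obtain ⟨ρ, hρ⟩ := (hUb j).subset_closedBall (d 0)
    exact ((ω.finite_inter_closedBall (d 0) ρ).preimage Subtype.val_injective.injOn).subset
      fun w hw => ⟨w.2, hρ hw⟩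
  set Λ : ∀ j (ω : PointConfig E), Finset (ω : Set E) := fun j ω => (hfin j ω).toFinset with hΛ
  have hΛmem : ∀ j (ω : PointConfig E) (w : (ω : Set E)), w ∈ Λ j ω ↔ (w : E) ∈ Uf j :=
    fun j ω w => by rw [hΛ, Set.Finite.mem_toFinset]; rfl
  -- the good events
  set LF : Set (PointConfig E) :=
    {ω | ∀ w, ((delaunayGraph (ω : Set E)).neighborSet w).Finite} with hLF
  set NE : Set (PointConfig E) := {ω | (ω : Set E).Nonempty} with hNE
  set UQ : Set (PointConfig E) :=
    ⋂ r : Fin n, {ω : PointConfig E | ∃! q, q ∈ ω ∧ ∀ q' ∈ ω, dist (x r) q ≤ dist (x r) q'}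
    with hUQ
  set Good : Set (PointConfig E) := NE ∩ LF ∩ UQ with hGood
  have hNEm : MeasurableSet NE := by
    have : NE = {ω : PointConfig E | ω.count univ = 0}ᶜ := by
      ext ω
      simp only [hNE, mem_setOf_eq, mem_compl_iff, count_eq_zero_iff_forall_notMem, mem_univ,
        not_true_eq_false, imp_false, not_forall, not_not]
      exact ⟨fun ⟨p, hp⟩ => ⟨p, hp⟩, fun ⟨p, hp⟩ => ⟨p, hp⟩⟩
    rw [this]
    exact (PointConfig.measurable_count MeasurableSet.univ (measurableSet_singleton 0)).compl
  have hLFm : MeasurableSet LF := measurableSet_locallyFinite_delaunay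
  have hUQm : MeasurableSet UQ := MeasurableSet.iInter fun r =>
    measurableSet_existsUnique_isNearest measurable_id measurable_const
  have hGoodm : MeasurableSet Good := (hNEm.inter hLFm).inter hUQm
  set Sj : Finset (ℕ × ℚ) → Set (PointConfig E) := fun j =>
    Good ∩ ⋂ r : Fin n, {ω : PointConfig E |
      ∃ q ∈ Uf j, q ∈ ω ∧ ∀ q' ∈ ω, dist (x r) q ≤ dist (x r) q'} with hSj
  have hSjm : ∀ j, MeasurableSet (Sj j) := fun j => hGoodm.inter (MeasurableSet.iInter fun r =>
    measurableSet_exists_isNearest_mem measurable_id measurable_const (hUm j))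
  have hSjne : ∀ j, ∀ ω ∈ Sj j, (ω : Set E).Nonempty := fun j ω hω => hω.1.1.1
  -- nearest vertices
  have hvS : ∀ j ω (hω : ω ∈ Sj j) r q, (q ∈ ω ∧ ∀ q' ∈ ω, dist (x r) q ≤ dist (x r) q') ↔
      q = (nearestVertex ω (hSjne j ω hω) (x r) : E) :=
    fun j ω hω r q => isNearest_iff_eq_nearestVertex_of_existsUnique ω _ (mem_iInter.1 hω.1.2 r) q
  have hvU : ∀ j ω (hω : ω ∈ Sj j) r, (nearestVertex ω (hSjne j ω hω) (x r) : E) ∈ Uf j :=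
    fun j ω hω r => by
    obtain ⟨q, hqU, hq⟩ := mem_iInter.1 hω.2 r
    rwa [(hvS j ω hω r q).1 hq] at hqU
  set H : Finset (ℕ × ℚ) → PointConfig E → ℝ := fun j ω =>
    if hω : ω ∈ Sj j then
      finVolExpect ω β (Λ j ω) (spinMonomial fun r => nearestVertex ω (hSjne j ω hω) (x r)) else 1
    with hH
  have hHm : ∀ j, Measurable (H j) := fun j =>
    measurable_finVolExpect_piecewise (hUm j) (hUb j) (Λ j) (hΛmem j) β x
      (fun ω hne r => nearestVertex ω hne (x r)) (hSjm j) (hSjne j)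
      (fun ω hω => hω.1.1.2) (hvS j) (hvU j) 1
  have hgm : Measurable fun ω => if ω ∈ Good then ⨅ j, H j ω else 0 :=
    Measurable.ite hGoodm (Measurable.iInf hHm) measurable_const
  -- `quenchedCorr` is this function off the null event of ties
  have hae : ∀ᵐ ω ∂P, ∀ r, Set.InjOn (fun p => dist (x r) p) ((ω : PointConfig E) : Set E) :=
    ae_all_iff.2 fun r => hP (x r)
  refine hgm.aestronglyMeasurable.congr ?_
  filter_upwards [hae] with ω hω
  unfold quenchedCorr
  by_cases hne : (ω : Set E).Nonempty
  · rw [dif_pos hne]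
    have huq : ω ∈ UQ := mem_iInter.2 fun r => existsUnique_isNearest_of_injOn ω hne (hω r)
    by_cases hlf : ∀ w, ((delaunayGraph (ω : Set E)).neighborSet w).Finite
    · have hgood : ω ∈ Good := ⟨⟨hne, hlf⟩, huq⟩
      rw [if_pos hgood]
      symm
      refine plusMonomialExpect_eq_iInf_finsetBalls ω β (fun r => nearestVertex ω hne (x r))
        (fun j => Λ j ω) (fun j w => hΛmem j ω w) (fun j => H j ω) (fun j hj => ?_) (fun j hj => ?_)
      · have hωS : ω ∈ Sj j := ⟨hgood, mem_iInter.2 fun r =>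
          ⟨_, (hΛmem j ω _).1 (hj r), isNearest_nearestVertex ω hne (x r)⟩⟩
        change H j ω = _
        simp only [hH, hωS, dif_pos]
      · have hωS : ω ∉ Sj j := fun h => hj fun r => (hΛmem j ω _).2 (hvU j ω h r)
        change H j ω = _
        simp only [hH, hωS, dif_neg, not_false_eq_true]
    · -- Delaunay graph not locally finite: all finite-volume values are the junk `0`
      have hgood : ω ∉ Good := fun h => hlf h.1.2
      rw [if_neg hgood]
      haveI : Nonempty {Λ' : Finset (ω : Set E) // ∀ i, nearestVertex ω hne (x i) ∈ Λ'} :=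
        ⟨⟨Finset.univ.image fun i => nearestVertex ω hne (x i), fun i =>
          Finset.mem_image_of_mem _ (Finset.mem_univ i)⟩⟩
      unfold plusMonomialExpect finVolExpect
      simp only [dif_neg hlf, ciInf_const]
  · rw [dif_neg hne]
    have hgood : ω ∉ Good := fun h => hne h.1.1
    rw [if_neg hgood]

end Quenched

end Literature.Probability.LatticeModels

end
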